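import Mathlib.LinearAlgebra.TensorProduct.Pi
import Literature.AlgebraicGeometry.Motives.HodgeStructureSemisimple
import Literature.AlgebraicGeometry.Motives.HodgeStructures
import HarnessLib

/-!
# Finite direct sums and Tate twists of polarised Hodge structures; Hodge classes in a sum of
images of morphisms of polarised Hodge structures (Voisin 2025, Cor. 2.12 for a family)

Layer `Literature/AlgebraicGeometry/Motives`; sequel to `HodgeStructureSemisimple` (Voisin 2025,
Prop. 2.11 and Cor. 2.12 for ONE surjective morphism `φ : H′ → H` from a polarised `H′`) and
`HodgeTensor` / `HodgeStructures` (`HodgeStructure.tateTwist`, `HodgeStructure.cast`,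
`piece_tateTwist`). Everything here is PROVED; no named fact is introduced. Sources, verbatim:

* C. Voisin, *Hodge and generalized Hodge conjectures, coniveau and algebraic cycles*, J. Open
  Math. Probl. 1 (2025), §2.1 (p. 20): "we can shift the bidegrees of `L` to get an effective
  Hodge structure `L′` of weight `k − 2c` […] where `L′ = L` and `L′^{p,q} = L^{p+c,q+c}`";
  (p. 23): "(up to a shift of bidegrees by `(n, n)` that is called a Tate twist) […] the Gysin
  morphism `φ_* : Hᵏ(X, ℚ) → H^{k−2d}(Y, ℚ)`, `d := dim X − dim Y`, is a morphism of Hodge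
  structures"; **Cor. 2.12** (p. 24): "Let `H, H′` be Hodge structures of weight `2k`, with `H′`
  polarized, and let `φ : H′ → H` be a surjective morphism of Hodge structures. Then
  `φ : Hdg(H′) → Hdg(H)` is surjective"; and its use for a Gysin morphism in the proof of
  Prop. 3.8 (p. 28): "The morphism `j_* ⊗ Id = (j, Id)_*` is a morphism of polarized Hodge
  structures, hence we can apply Corollary 2.12 to conclude that `δ₁ = (j, Id)_*(β)` for some
  degree 2 Hodge class `β`".
* P. Deligne, *Théorie de Hodge II*, Publ. Math. IHÉS 40 (1971), 2.1 (direct sums of Hodge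
  structures), 2.1.13–2.1.15 (Tate twists, polarisations).
* U. Jannsen, *Mixed Motives and Algebraic K-Theory*, LNM 1400 (1990), §7, 7.8: for a FAMILY
  of morphisms, "`Γπ_* ∘ Γα*` is still surjective […] if b) `H_{2i}(X'', i)` is a semi-simple
  object" — the mechanism below (`Hdg` of a finite direct sum is the direct sum of the `Hdg`).

## Main results (namespace `HodgeStructure`)

* Tate twists and transport of weight keep Hodge classes and polarisations (the pieces shift:
  `piece_tateTwist` of `HodgeStructures`): `tateTwist_hodgeClasses`, `Polarization.tateTwist`,
  `IsPolarizable.tateTwist`, `cast_piece`, `cast_hodgeClasses`, `Polarization.cast`,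
  `IsPolarizable.cast`.
* Sub-Hodge structures of polarised structures are polarised by restriction (Voisin I,
  Lemma 7.26, first clause): `Polarization.restrict`, `SubHodgeStructure.isPolarizable`;
  `SubHodgeStructure.mem_hodgeClasses_iff`.
* **Finite direct sums** `HodgeStructure.pi H` of Hodge structures `H j` (`j : ι`, `ι` finite) of
  a common weight on `Π j, W j` (Deligne, Hodge II, 2.1): filtration, pieces and Hodge classes are
  computed componentwise (`mem_pi_F_iff`, `mem_pi_piece_iff`, `mem_hodgeClasses_pi_iff`); the
  direct sum of polarisations polarises it (`Polarization.pi`, `IsPolarizable.pi`); the morphism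
  `Hom.piDesc φ = Σⱼ φⱼ ∘ prⱼ : ⊕ⱼ Hⱼ → H` defined by a family `φⱼ : Hⱼ → H` and its range
  (`Hom.range_piDesc`).
* Images of morphisms are sub-Hodge structures (`Hom.exists_subHodgeStructure_range`) and
  morphisms co-restrict to sub-Hodge structures containing their image (`Hom.codRestrict`).
* **`mem_iSup_map_hodgeClasses_of_mem_iSup_range`** — Cor. 2.12 for a finite family: for
  morphisms `φⱼ : Hⱼ → H` of Hodge structures of weight `2k` with every `Hⱼ` finite-dimensional
  and polarisable, a Hodge class of `H` lying in `Σⱼ im φⱼ` lies in `Σⱼ φⱼ(Hdgᵏ(Hⱼ))` (apply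
  Cor. 2.12 to `⊕ⱼ Hⱼ → im`, the image being a sub-Hodge structure and `⊕ⱼ Hⱼ` polarised).
* **`mem_iSup_map_hodgeClasses_of_bidegree`** — the same for maps `φⱼ : Wⱼ → V` of bidegree
  `(eⱼ, eⱼ)` from Hodge structures of weights `wⱼ`, `wⱼ + 2eⱼ = 2k` (i.e. morphisms
  `Hⱼ(−eⱼ) → H` from the Tate twists — the shape of a family of Gysin morphisms, p. 23): a Hodge
  class of `H` in `Σⱼ im φⱼ` lies in `Σⱼ φⱼ(Hdg^{k−eⱼ}(Hⱼ))`; and its complexified reading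
  `ofRat_mem_iSup_map_span_of_bidegree` (a Hodge class whose image in `V_ℂ` lies in
  `Σⱼ im (φⱼ)_ℂ` lies in `Σⱼ (φⱼ)_ℂ (span_ℂ Hdg^{k−eⱼ}(Hⱼ))`), which is the abstract form of the
  named fact `HodgeTheory.Voisin2025_hodgeClass_lift_complexGysin` (`HodgeTheory/GysinHodgeClassLift`)
  — what remains for the latter is the identification of its carriers (`complexBetti`,
  `IsRationalClass`, `IsOfHodgeType`, `complexGysin`) with polarised `ℚ`-Hodge structures and
  Gysin morphisms of bidegree `(e, e)`, not done here.

## References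

* [Voisin2025] C. Voisin, Hodge and generalized Hodge conjectures, coniveau and algebraic cycles,
  J. Open Math. Probl. 1 (2025) 16–51, §2.1, Prop. 2.11, Cor. 2.12, proof of Prop. 3.8.
* [DeligneHodgeII1971] P. Deligne, Théorie de Hodge II, Publ. Math. IHÉS 40 (1971), 2.1,
  2.1.13–2.1.15.
* [VoisinHodgeI2002] C. Voisin, Hodge Theory and Complex Algebraic Geometry I, CUP 2002,
  Lemma 7.26, §7.3.2.
* [Jannsen1990MixedMotives] U. Jannsen, Mixed Motives and Algebraic K-Theory, LNM 1400, §7, 7.8.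
-/

open scoped TensorProduct

noncomputable section

namespace Literature.AlgebraicGeometry.Motives

namespace HodgeStructure

universe u v w

variable {V : Type u} [AddCommGroup V] [Module ℚ V]
variable {V' : Type v} [AddCommGroup V'] [Module ℚ V']
variable {n m : ℤ}

/-! ### Transport of weight and Tate twists: pieces, Hodge classes, polarisations -/

/-- The Hodge pieces of a weight-transported Hodge structure are unchanged. [folklore] -/
theorem cast_piece (H : HodgeStructure V n) (h : n = m) (p q : ℤ) :
    (H.cast h).piece p q = H.piece p q := by
  subst h
  rfl

/-- The Hodge classes of a weight-transported Hodge structure are unchanged. [folklore] -/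
theorem cast_hodgeClasses (H : HodgeStructure V n) (h : n = m) (p : ℤ) :
    (H.cast h).hodgeClasses p = H.hodgeClasses p :=
  rfl

/-- A polarisation polarises the weight-transported structure (same form). [folklore] -/
def Polarization.cast {H : HodgeStructure V n} (Q : Polarization H) (h : n = m) :
    Polarization (H.cast h) where
  form := Q.form
  flip_form := by
    subst h
    exact Q.flip_form
  form_apply_eq_zero p x hx y hy := by
    subst h
    exact Q.form_apply_eq_zero p x hx y hy
  pos p q hpq x hx hx0 := by
    subst h
    exact Q.pos p q hpq x hx hx0

/-- Polarisability is invariant under transport of weight. [folklore] -/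
theorem IsPolarizable.cast {H : HodgeStructure V n} (hH : H.IsPolarizable) (h : n = m) :
    (H.cast h).IsPolarizable :=
  ⟨hH.some.cast h⟩

/-- The Hodge classes of a Tate twist: `Hdgᵖ(H(j)) = Hdg^{p+j}(H)` (same rational vectors,
shifted index). [cite: Voisin2025, §2.1 (p. 20)] -/
theorem tateTwist_hodgeClasses (H : HodgeStructure V n) (j p : ℤ) :
    (H.tateTwist j).hodgeClasses p = H.hodgeClasses (p + j) :=
  rfl

/-- The powers of `i` in the second Hodge–Riemann relation are invariant under a Tate twist:
`i^{p+j} / i^{q+j} = i^p / i^q`. [folklore] -/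
theorem I_zpow_add_mul_inv (p q j : ℤ) :
    Complex.I ^ (p + j) * (Complex.I ^ (q + j))⁻¹ = Complex.I ^ p * (Complex.I ^ q)⁻¹ := by
  rw [zpow_add₀ Complex.I_ne_zero, zpow_add₀ Complex.I_ne_zero, mul_inv, mul_mul_mul_comm,
    mul_inv_cancel₀ (zpow_ne_zero j Complex.I_ne_zero), mul_one]

/-- **A polarisation of `H` polarises every Tate twist `H(j)`** (same form: the weight changes
by the even number `2j`, the Hodge–Riemann relations are shifted along with the pieces).
[cite: DeligneHodgeII1971, 2.1.14–2.1.15] [cite: Voisin2025, §2.1 (p. 20)] -/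
def Polarization.tateTwist {H : HodgeStructure V n} (Q : Polarization H) (j : ℤ) :
    Polarization (H.tateTwist j) where
  form := Q.form
  flip_form := by
    have h : (n - 2 * j).negOnePow = n.negOnePow := by
      rw [Int.negOnePow_sub, Int.negOnePow_two_mul, mul_one]
    rw [h]
    exact Q.flip_form
  form_apply_eq_zero p x hx y hy := by
    rw [tateTwist_F] at hx hy
    rw [show n - 2 * j + 1 - p + j = n + 1 - (p + j) by ring] at hy
    exact Q.form_apply_eq_zero (p + j) x hx y hy
  pos p q hpq x hx hx0 := by
    rw [piece_tateTwist] at hx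
    obtain ⟨r, hr, hQ⟩ := Q.pos (p + j) (q + j) (by omega) x hx hx0
    exact ⟨r, hr, by rw [← I_zpow_add_mul_inv p q j]; exact hQ⟩

/-- Tate twists of polarisable Hodge structures are polarisable. [cite: DeligneHodgeII1971, 2.1.15] -/
theorem IsPolarizable.tateTwist {H : HodgeStructure V n} (hH : H.IsPolarizable) (j : ℤ) :
    (H.tateTwist j).IsPolarizable :=
  ⟨hH.some.tateTwist j⟩

/-! ### Base change: sums, images, rational vectors -/

/-- Base change of a finite sum of linear maps. [folklore] -/
theorem baseChange_finset_sum {ι : Type w} (s : Finset ι) (f : ι → V' →ₗ[ℚ] V) :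
    (∑ j ∈ s, f j).baseChange ℂ = ∑ j ∈ s, (f j).baseChange ℂ :=
  map_sum (LinearMap.baseChangeHom ℚ ℂ V' V) f s

/-- The image of a complexified map is the complexification of the image (`ℂ ⊗ –` is right
exact). [folklore] -/
theorem range_baseChange (φ : V' →ₗ[ℚ] V) :
    LinearMap.range (φ.baseChange ℂ) = (LinearMap.range φ).baseChange ℂ := by
  rw [LinearMap.range_eq_map φ, baseChange_map, Submodule.baseChange_top, Submodule.map_top,
    LinearMap.range_eq_map]

/-- The rational vectors of `V` inside `V_ℂ`: `ofRat` commutes with every linear map,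
`(φ v) ⊗ 1 = φ_ℂ (v ⊗ 1)`. [folklore] -/
theorem baseChange_ofRat (φ : V' →ₗ[ℚ] V) (v : V') : φ.baseChange ℂ (ofRat v) = ofRat (φ v) := by
  rw [ofRat_apply, ofRat_apply, LinearMap.baseChange_tmul]

/-! ### Sub-Hodge structures of polarised Hodge structures -/

/-- Base change of a composite bilinear form: `(Q ∘ (f, f))_ℂ (x, y) = Q_ℂ (f_ℂ x, f_ℂ y)`. [folklore] -/
theorem baseChange_compl₁₂ (Q : LinearMap.BilinForm ℚ V) (f : V' →ₗ[ℚ] V) (x y : ℂ ⊗[ℚ] V') :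
    LinearMap.BilinForm.baseChange ℂ (Q.compl₁₂ f f) x y =
      Q.baseChange ℂ (f.baseChange ℂ x) (f.baseChange ℂ y) := by
  induction x using TensorProduct.induction_on with
  | zero => rw [map_zero, map_zero, LinearMap.zero_apply, map_zero, LinearMap.zero_apply]
  | tmul a v =>
    induction y using TensorProduct.induction_on with
    | zero => rw [map_zero, map_zero, map_zero]
    | tmul b w =>
      rw [LinearMap.BilinForm.baseChange_tmul, LinearMap.baseChange_tmul, LinearMap.baseChange_tmul,
        LinearMap.BilinForm.baseChange_tmul, LinearMap.compl₁₂_apply]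
    | add y₁ y₂ h₁ h₂ => rw [map_add, map_add, map_add, h₁, h₂]
  | add x₁ x₂ h₁ h₂ =>
    rw [map_add, map_add, LinearMap.add_apply, map_add, LinearMap.add_apply, h₁, h₂]

/-- For a sub-Hodge structure `W ⊆ V`, an element of `W_ℂ` lies in the piece `W^{p,q}` of the
induced structure iff its image in `V_ℂ` lies in `V^{p,q}` (`W^{p,q} = W_ℂ ∩ V^{p,q}`, Voisin I,
§7.3.1 Def. 7.24). [cite: VoisinHodgeI2002, §7.3.1 Def. 7.24] -/
theorem SubHodgeStructure.mem_piece_iff {H : HodgeStructure V n} (S : SubHodgeStructure H)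
    {p q : ℤ} {x : ℂ ⊗[ℚ] S.toSubmodule} :
    x ∈ S.toHodgeStructure.piece p q ↔ S.toSubmodule.subtype.baseChange ℂ x ∈ H.piece p q := by
  by_cases hpq : p + q = n
  · rw [HodgeStructure.mem_piece_iff _ hpq, HodgeStructure.mem_piece_iff _ hpq,
      toHodgeStructure_F, toHodgeStructure_F, Submodule.mem_comap, Submodule.mem_comap,
      conj_baseChange]
  · rw [piece_eq_bot_of_add_ne _ hpq, piece_eq_bot_of_add_ne _ hpq, Submodule.mem_bot,
      Submodule.mem_bot, ← LinearMap.map_eq_zero_iff _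
        (baseChange_injective_of_injective S.toSubmodule.injective_subtype)]

/-- The Hodge classes of the induced structure on a sub-Hodge structure `W ⊆ V` are the Hodge
classes of `V` lying in `W`: `Hdgᵖ(W) = W ∩ Hdgᵖ(V)`. [cite: VoisinHodgeI2002, §7.3.1] -/
theorem SubHodgeStructure.mem_hodgeClasses_iff {H : HodgeStructure V n} (S : SubHodgeStructure H)
    (p : ℤ) (v : S.toSubmodule) :
    v ∈ S.toHodgeStructure.hodgeClasses p ↔ (v : V) ∈ H.hodgeClasses p := by
  rw [HodgeStructure.mem_hodgeClasses_iff, HodgeStructure.mem_hodgeClasses_iff,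
    toHodgeStructure_F, Submodule.mem_comap, ofRat_apply, ofRat_apply, LinearMap.baseChange_tmul,
    Submodule.subtype_apply]

/-- **The restriction of a polarisation to a sub-Hodge structure is a polarisation** (Voisin I,
Lemma 7.26: "if the Hodge structure on `W` is polarised, the same holds for the Hodge structure
on `V`" for a sub-Hodge structure `V_ℚ ⊂ W_ℚ`): the Hodge–Riemann relations are inherited, the
pieces of the sub-structure being `W_ℂ ∩ V^{p,q}`. [cite: VoisinHodgeI2002, Lemma 7.26] -/
def Polarization.restrict {H : HodgeStructure V n} (Q : Polarization H) (S : SubHodgeStructure H) :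
    Polarization S.toHodgeStructure where
  form := Q.form.compl₁₂ S.toSubmodule.subtype S.toSubmodule.subtype
  flip_form := by
    refine LinearMap.ext fun x ↦ LinearMap.ext fun y ↦ ?_
    have h := LinearMap.congr_fun₂ Q.flip_form (x : V) (y : V)
    simp only [LinearMap.BilinForm.flip_apply, LinearMap.smul_apply, LinearMap.compl₁₂_apply,
      Submodule.subtype_apply] at h ⊢
    exact h
  form_apply_eq_zero p x hx y hy := by
    rw [SubHodgeStructure.toHodgeStructure_F, Submodule.mem_comap] at hx hy
    rw [baseChange_compl₁₂]
    exact Q.form_apply_eq_zero p _ hx _ hy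
  pos p q hpq x hx hx0 := by
    rw [SubHodgeStructure.mem_piece_iff] at hx
    have hx0' : S.toSubmodule.subtype.baseChange ℂ x ≠ 0 := fun h ↦ hx0
      (baseChange_injective_of_injective S.toSubmodule.injective_subtype (by rw [h, map_zero]))
    obtain ⟨r, hr, hQ⟩ := Q.pos p q hpq _ hx hx0'
    refine ⟨r, hr, ?_⟩
    rw [baseChange_compl₁₂, ← conj_baseChange]
    exact hQ

/-- Sub-Hodge structures of polarisable Hodge structures are polarisable.
[cite: VoisinHodgeI2002, Lemma 7.26] -/
theorem SubHodgeStructure.isPolarizable {H : HodgeStructure V n} (hH : H.IsPolarizable)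
    (S : SubHodgeStructure H) : S.toHodgeStructure.IsPolarizable :=
  ⟨hH.some.restrict S⟩

/-! ### Images of morphisms; co-restriction -/

/-- **The image of a morphism of Hodge structures is a sub-Hodge structure** (Voisin I, §7.3.1;
Deligne, Hodge II, 2.1): `(im φ)_ℂ = im φ_ℂ = Σ_p φ_ℂ(V'^{p,n-p})` and
`φ_ℂ(V'^{p,n-p}) ⊆ im φ_ℂ ∩ V^{p,n-p}`. [cite: VoisinHodgeI2002, §7.3.1] -/
theorem Hom.exists_subHodgeStructure_range {H' : HodgeStructure V' n} {H : HodgeStructure V n}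
    (φ : Hom H' H) :
    ∃ S : SubHodgeStructure H, S.toSubmodule = LinearMap.range φ.toLinearMap := by
  refine SubHodgeStructure.exists_eq_of_baseChange_le _ ?_
  rw [← range_baseChange]
  rintro _ ⟨y, rfl⟩
  have hy : y ∈ ⨆ p : ℤ, H'.piece p (n - p) := by
    rw [iSup_piece_eq_top_holds H']
    exact Submodule.mem_top
  induction hy using Submodule.iSup_induction' with
  | mem p y hy =>
    exact Submodule.mem_iSup_of_mem p ⟨⟨y, rfl⟩, φ.map_piece_le p (n - p) ⟨y, hy, rfl⟩⟩
  | zero =>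
    rw [map_zero]
    exact Submodule.zero_mem _
  | add y₁ y₂ _ _ h₁ h₂ =>
    rw [map_add]
    exact Submodule.add_mem _ h₁ h₂

/-- **Co-restriction** of a morphism of Hodge structures to a sub-Hodge structure of the target
containing its image (the induced filtration on the sub-structure is the pull-back of `F`).
[cite: VoisinHodgeI2002, §7.3.1] -/
def Hom.codRestrict {H' : HodgeStructure V' n} {H : HodgeStructure V n} (φ : Hom H' H)
    (S : SubHodgeStructure H) (h : ∀ v, φ.toLinearMap v ∈ S.toSubmodule) :
    Hom H' S.toHodgeStructure where
  toLinearMap := φ.toLinearMap.codRestrict S.toSubmodule h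
  map_F_le p := by
    rintro _ ⟨x, hx, rfl⟩
    rw [SubHodgeStructure.toHodgeStructure_F, Submodule.mem_comap, ← LinearMap.comp_apply,
      ← LinearMap.baseChange_comp, LinearMap.subtype_comp_codRestrict]
    exact φ.map_F_le p ⟨x, hx, rfl⟩

/-- The co-restriction has the same underlying vectors. [folklore] -/
@[simp]
theorem Hom.coe_codRestrict_apply {H' : HodgeStructure V' n} {H : HodgeStructure V n}
    (φ : Hom H' H) (S : SubHodgeStructure H) (h : ∀ v, φ.toLinearMap v ∈ S.toSubmodule) (v : V') :
    ((φ.codRestrict S h).toLinearMap v : V) = φ.toLinearMap v :=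
  rfl

/-! ### Finite direct sums of Hodge structures -/

section Pi

variable {ι : Type w} [Fintype ι] [DecidableEq ι]
variable {W : ι → Type v} [∀ j, AddCommGroup (W j)] [∀ j, Module ℚ (W j)]

variable (W) in
/-- The `ℂ`-linear identification `ℂ ⊗ (Π j, W j) ≃ Π j, (ℂ ⊗ W j)` (`ι` finite) used for finite
direct sums (Mathlib's `TensorProduct.piRight`). [folklore] -/
def piEquiv : ℂ ⊗[ℚ] (∀ j, W j) ≃ₗ[ℂ] ∀ j, ℂ ⊗[ℚ] W j :=
  TensorProduct.piRight ℚ ℂ ℂ W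

/-- `piEquiv` on pure tensors. [folklore] -/
@[simp]
theorem piEquiv_tmul (c : ℂ) (v : ∀ j, W j) : piEquiv W (c ⊗ₜ[ℚ] v) = fun j ↦ c ⊗ₜ[ℚ] v j :=
  rfl

/-- The components of `piEquiv` are the base changes of the projections. [folklore] -/
theorem proj_baseChange_apply (j : ι) (x : ℂ ⊗[ℚ] (∀ i, W i)) :
    (LinearMap.proj j : (∀ i, W i) →ₗ[ℚ] W j).baseChange ℂ x = piEquiv W x j := by
  induction x using TensorProduct.induction_on with
  | zero => simp
  | tmul c v => simp
  | add x y hx hy => rw [map_add, map_add, hx, hy, Pi.add_apply]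

/-- `conj` on `ℂ ⊗ (Π j, W j)` is componentwise under `piEquiv`: `(conj x)_j = conj (x_j)`.
[folklore] -/
theorem piEquiv_conj (x : ℂ ⊗[ℚ] (∀ j, W j)) (j : ι) :
    piEquiv W (conj x) j = conj (piEquiv W x j) := by
  induction x using TensorProduct.induction_on with
  | zero => rw [map_zero, map_zero, Pi.zero_apply, map_zero]
  | tmul c v => rw [conj_tmul, piEquiv_tmul, piEquiv_tmul, conj_tmul]
  | add x y hx hy => rw [map_add, map_add, Pi.add_apply, hx, hy, map_add, Pi.add_apply, map_add]

/-- Conjugation is compatible with products of subspaces under `piEquiv`. [folklore] -/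
theorem complexConj_comap_pi (A : ∀ j, Submodule ℂ (ℂ ⊗[ℚ] W j)) :
    complexConj ((Submodule.pi Set.univ A).comap (piEquiv W : ℂ ⊗[ℚ] (∀ j, W j) →ₗ[ℂ] _)) =
      (Submodule.pi Set.univ fun j ↦ complexConj (A j)).comap
        (piEquiv W : ℂ ⊗[ℚ] (∀ j, W j) →ₗ[ℂ] _) := by
  ext x
  simp only [mem_complexConj, Submodule.mem_comap, LinearEquiv.coe_coe, Submodule.mem_pi,
    Set.mem_univ, forall_const, piEquiv_conj]

/-- **The direct sum of a finite family of Hodge structures of the same weight** (Deligne,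
Hodge II, 2.1): on `Π j, W j`, the filtration `F^p = Π j, F^p W_j` (read through `piEquiv`).
[cite: DeligneHodgeII1971, 2.1] -/
def pi (H : ∀ j, HodgeStructure (W j) n) : HodgeStructure (∀ j, W j) n where
  F p := (Submodule.pi Set.univ fun j ↦ (H j).F p).comap
    (piEquiv W : ℂ ⊗[ℚ] (∀ j, W j) →ₗ[ℂ] _)
  antitone_F _ _ h := Submodule.comap_mono (Submodule.pi_mono fun j _ ↦ (H j).antitone_F h)
  exists_F_eq_top := by
    choose P hP using fun j ↦ (H j).exists_F_eq_top
    refine ⟨-∑ j, |P j|, ?_⟩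
    rw [eq_top_iff]
    rintro x -
    simp only [Submodule.mem_comap, Submodule.mem_pi, Set.mem_univ, forall_const]
    intro j
    have hle : -∑ i, |P i| ≤ P j := by
      have h1 : |P j| ≤ ∑ i, |P i| :=
        Finset.single_le_sum (f := fun i ↦ |P i|) (fun i _ ↦ abs_nonneg (P i)) (Finset.mem_univ j)
      have h2 : -|P j| ≤ P j := neg_abs_le (P j)
      omega
    have htop : (H j).F (-∑ i, |P i|) = ⊤ := eq_top_iff.2 ((hP j) ▸ (H j).antitone_F hle)
    rw [htop]
    exact Submodule.mem_top
  exists_F_eq_bot := by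
    choose P hP using fun j ↦ (H j).exists_F_eq_bot
    refine ⟨∑ j, |P j|, ?_⟩
    rw [eq_bot_iff]
    intro x hx
    simp only [Submodule.mem_comap, Submodule.mem_pi, Set.mem_univ, forall_const] at hx
    rw [Submodule.mem_bot, ← (piEquiv W).map_eq_zero_iff]
    funext j
    have hle : P j ≤ ∑ i, |P i| :=
      (le_abs_self (P j)).trans
        (Finset.single_le_sum (f := fun i ↦ |P i|) (fun i _ ↦ abs_nonneg (P i)) (Finset.mem_univ j))
    have hbot : (H j).F (∑ i, |P i|) = ⊥ := eq_bot_iff.2 ((hP j) ▸ (H j).antitone_F hle)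
    have hxj := hx j
    rw [hbot, Submodule.mem_bot] at hxj
    exact hxj
  isCompl_F_complexConj p q h := by
    rw [complexConj_comap_pi]
    refine ((Submodule.orderIsoMapComap (piEquiv W)).symm.isCompl_iff).1 ?_
    refine ⟨?_, ?_⟩
    · rw [Submodule.disjoint_def]
      intro x hx hx'
      simp only [Submodule.mem_pi, Set.mem_univ, forall_const] at hx hx'
      funext j
      exact (Submodule.disjoint_def.1 ((H j).isCompl_F_complexConj p q h).disjoint) _ (hx j) (hx' j)
    · rw [codisjoint_iff, eq_top_iff]
      rintro x -
      have hx : ∀ j, ∃ a ∈ (H j).F p, ∃ b ∈ complexConj ((H j).F q), a + b = x j := fun j ↦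
        Submodule.mem_sup.1 (by
          rw [((H j).isCompl_F_complexConj p q h).codisjoint.eq_top]
          exact Submodule.mem_top)
      choose a ha b hb hab using hx
      have hx' : x = a + b := funext fun j ↦ (hab j).symm
      rw [hx']
      exact Submodule.add_mem_sup
        ((Submodule.mem_pi).2 fun j _ ↦ ha j) ((Submodule.mem_pi).2 fun j _ ↦ hb j)

/-- The filtration of the direct sum. [cite: DeligneHodgeII1971, 2.1] -/
theorem pi_F (H : ∀ j, HodgeStructure (W j) n) (p : ℤ) :
    (pi H).F p = (Submodule.pi Set.univ fun j ↦ (H j).F p).comap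
      (piEquiv W : ℂ ⊗[ℚ] (∀ j, W j) →ₗ[ℂ] _) :=
  rfl

/-- Membership in the filtration of the direct sum is componentwise. [cite: DeligneHodgeII1971, 2.1] -/
theorem mem_pi_F_iff (H : ∀ j, HodgeStructure (W j) n) {p : ℤ} {x : ℂ ⊗[ℚ] (∀ j, W j)} :
    x ∈ (pi H).F p ↔ ∀ j, piEquiv W x j ∈ (H j).F p := by
  simp only [pi_F, Submodule.mem_comap, LinearEquiv.coe_coe, Submodule.mem_pi, Set.mem_univ,
    forall_const]

/-- **The Hodge pieces of the direct sum are the direct sums of the pieces**: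
`x ∈ (⊕ W_j)^{p,q} ↔ ∀ j, x_j ∈ W_j^{p,q}`. [cite: DeligneHodgeII1971, 2.1] -/
theorem mem_pi_piece_iff (H : ∀ j, HodgeStructure (W j) n) {p q : ℤ} (hpq : p + q = n)
    {x : ℂ ⊗[ℚ] (∀ j, W j)} :
    x ∈ (pi H).piece p q ↔ ∀ j, piEquiv W x j ∈ (H j).piece p q := by
  simp only [mem_piece_iff _ hpq, mem_pi_F_iff, piEquiv_conj]
  exact ⟨fun h j ↦ ⟨h.1 j, h.2 j⟩, fun h ↦ ⟨fun j ↦ (h j).1, fun j ↦ (h j).2⟩⟩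

/-- **The Hodge classes of the direct sum are the families of Hodge classes**:
`Hdgᵖ(⊕ H_j) = Π_j Hdgᵖ(H_j)`. [cite: DeligneHodgeII1971, 2.1] -/
theorem mem_hodgeClasses_pi_iff (H : ∀ j, HodgeStructure (W j) n) {p : ℤ} {v : ∀ j, W j} :
    v ∈ (pi H).hodgeClasses p ↔ ∀ j, v j ∈ (H j).hodgeClasses p := by
  simp only [mem_hodgeClasses_iff, mem_pi_F_iff, ofRat_apply, piEquiv_tmul]

/-- The complexification of a direct sum of bilinear forms, computed componentwise. [folklore] -/
theorem baseChange_sum_compl₁₂_proj (Q : ∀ j, LinearMap.BilinForm ℚ (W j))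
    (x y : ℂ ⊗[ℚ] (∀ j, W j)) :
    LinearMap.BilinForm.baseChange ℂ
        (∑ j, (Q j).compl₁₂ (LinearMap.proj j) (LinearMap.proj j)) x y =
      ∑ j, (Q j).baseChange ℂ (piEquiv W x j) (piEquiv W y j) := by
  induction x using TensorProduct.induction_on with
  | zero => simp
  | tmul a v =>
    induction y using TensorProduct.induction_on with
    | zero => simp
    | tmul b w =>
      simp [LinearMap.BilinForm.baseChange_tmul, Finset.sum_smul]
    | add y₁ y₂ h₁ h₂ => rw [map_add, map_add, h₁, h₂, ← Finset.sum_add_distrib]; simp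
  | add x₁ x₂ h₁ h₂ =>
    rw [map_add, map_add, LinearMap.add_apply, h₁, h₂, ← Finset.sum_add_distrib]
    simp

/-- **The direct sum of polarisations is a polarisation of the direct sum**
`Q((v_j), (w_j)) = Σ_j Q_j(v_j, w_j)`: the Hodge–Riemann relations hold componentwise, and
`i^{p-q} Q(x, conj x) = Σ_j i^{p-q} Q_j(x_j, conj x_j)` is a sum of positive reals over the
non-zero components of `x ≠ 0`. [cite: DeligneHodgeII1971, 2.1.15] [cite: VoisinHodgeI2002, §7.1.2] -/
def Polarization.pi {H : ∀ j, HodgeStructure (W j) n} (Q : ∀ j, Polarization (H j)) :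
    Polarization (pi H) where
  form := ∑ j, (Q j).form.compl₁₂ (LinearMap.proj j) (LinearMap.proj j)
  flip_form := by
    refine LinearMap.ext fun v ↦ LinearMap.ext fun v' ↦ ?_
    simp only [LinearMap.BilinForm.flip_apply, LinearMap.coe_sum, Finset.sum_apply,
      LinearMap.smul_apply, LinearMap.compl₁₂_apply, LinearMap.proj_apply, Finset.smul_sum]
    refine Finset.sum_congr rfl fun j _ ↦ ?_
    have h := LinearMap.congr_fun₂ (Q j).flip_form (v j) (v' j)
    simp only [LinearMap.BilinForm.flip_apply, LinearMap.smul_apply] at h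
    exact h
  form_apply_eq_zero p x hx y hy := by
    rw [mem_pi_F_iff] at hx hy
    rw [baseChange_sum_compl₁₂_proj]
    exact Finset.sum_eq_zero fun j _ ↦ (Q j).form_apply_eq_zero p _ (hx j) _ (hy j)
  pos p q hpq x hx hx0 := by
    have hxj : ∀ j, piEquiv W x j ∈ (H j).piece p q := (mem_pi_piece_iff H hpq).1 hx
    have key : ∀ j, ∃ r : ℝ, 0 ≤ r ∧ (piEquiv W x j ≠ 0 → 0 < r) ∧
        Complex.I ^ p * (Complex.I ^ q)⁻¹ *
          (Q j).form.baseChange ℂ (piEquiv W x j) (conj (piEquiv W x j)) = r := by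
      intro j
      by_cases h0 : piEquiv W x j = 0
      · refine ⟨0, le_rfl, fun h ↦ (h h0).elim, ?_⟩
        rw [h0, map_zero, LinearMap.zero_apply, mul_zero, Complex.ofReal_zero]
      · obtain ⟨r, hr, hQ⟩ := (Q j).pos p q hpq _ (hxj j) h0
        exact ⟨r, hr.le, fun _ ↦ hr, hQ⟩
    choose r hr0 hrpos hr using key
    obtain ⟨j₀, hj₀⟩ : ∃ j, piEquiv W x j ≠ 0 := by
      by_contra hall
      push Not at hall
      exact hx0 ((piEquiv W).map_eq_zero_iff.1 (funext hall))
    refine ⟨∑ j, r j, Finset.sum_pos' (fun j _ ↦ hr0 j) ⟨j₀, Finset.mem_univ _, hrpos j₀ hj₀⟩, ?_⟩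
    rw [baseChange_sum_compl₁₂_proj, Finset.mul_sum, Complex.ofReal_sum]
    refine Finset.sum_congr rfl fun j _ ↦ ?_
    rw [piEquiv_conj]
    exact hr j

/-- Finite direct sums of polarisable Hodge structures are polarisable.
[cite: DeligneHodgeII1971, 2.1.15] -/
theorem IsPolarizable.pi {H : ∀ j, HodgeStructure (W j) n} (hH : ∀ j, (H j).IsPolarizable) :
    (pi H).IsPolarizable :=
  ⟨Polarization.pi fun j ↦ (hH j).some⟩

/-- **The morphism `⊕_j H_j → H` defined by a family of morphisms `φ_j : H_j → H`**:
`(v_j)_j ↦ Σ_j φ_j(v_j)` (Deligne, Hodge II, 2.1: Hodge structures form an additive — indeed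
abelian — category). [cite: DeligneHodgeII1971, 2.1] -/
def Hom.piDesc {H : ∀ j, HodgeStructure (W j) n} {H₀ : HodgeStructure V n}
    (φ : ∀ j, Hom (H j) H₀) : Hom (pi H) H₀ where
  toLinearMap := ∑ j, (φ j).toLinearMap ∘ₗ LinearMap.proj j
  map_F_le p := by
    rintro _ ⟨x, hx, rfl⟩
    rw [SetLike.mem_coe, mem_pi_F_iff] at hx
    rw [baseChange_finset_sum, LinearMap.coe_sum, Finset.sum_apply]
    refine Submodule.sum_mem _ fun j _ ↦ ?_
    rw [LinearMap.baseChange_comp, LinearMap.comp_apply, proj_baseChange_apply]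
    exact (φ j).map_F_le p ⟨_, hx j, rfl⟩

/-- `piDesc φ (v_j)_j = Σ_j φ_j(v_j)`. [folklore] -/
theorem Hom.piDesc_apply {H : ∀ j, HodgeStructure (W j) n} {H₀ : HodgeStructure V n}
    (φ : ∀ j, Hom (H j) H₀) (v : ∀ j, W j) :
    (Hom.piDesc φ).toLinearMap v = ∑ j, (φ j).toLinearMap (v j) := by
  simp [Hom.piDesc]

/-- `piDesc φ` on a vector supported at `j` is `φ_j`. [folklore] -/
theorem Hom.piDesc_single {H : ∀ j, HodgeStructure (W j) n} {H₀ : HodgeStructure V n}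
    (φ : ∀ j, Hom (H j) H₀) (j : ι) (w : W j) :
    (Hom.piDesc φ).toLinearMap (Pi.single j w) = (φ j).toLinearMap w := by
  rw [Hom.piDesc_apply]
  rw [Finset.sum_eq_single j (fun i _ hij ↦ by rw [Pi.single_eq_of_ne hij, map_zero])
    (fun h ↦ (h (Finset.mem_univ j)).elim), Pi.single_eq_same]

/-- **The image of `⊕_j H_j → H` is the sum of the images of the `φ_j`.** [folklore] -/
theorem Hom.range_piDesc {H : ∀ j, HodgeStructure (W j) n} {H₀ : HodgeStructure V n}
    (φ : ∀ j, Hom (H j) H₀) :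
    LinearMap.range (Hom.piDesc φ).toLinearMap = ⨆ j, LinearMap.range (φ j).toLinearMap := by
  apply le_antisymm
  · rintro _ ⟨v, rfl⟩
    rw [Hom.piDesc_apply]
    exact Submodule.sum_mem _ fun j _ ↦ Submodule.mem_iSup_of_mem j ⟨v j, rfl⟩
  · refine iSup_le fun j ↦ ?_
    rintro _ ⟨w, rfl⟩
    exact ⟨Pi.single j w, Hom.piDesc_single φ j w⟩

end Pi

/-! ### Cor. 2.12 for a finite family of morphisms of polarised Hodge structures -/

/-- **Hodge classes in a sum of images of morphisms from polarised Hodge structures**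
(Voisin 2025, Cor. 2.12, applied — as in the proof of Prop. 3.8, ibid., and in Jannsen 1990,
§7, 7.8 — to the morphism `⊕ⱼ Hⱼ → H` defined by a finite family): let `φⱼ : Hⱼ → H` (`j ∈ ι`
finite) be morphisms of Hodge structures of weight `n = 2k`, every `Hⱼ` being finite-dimensional
and polarisable. Then every Hodge class of `H` lying in `Σⱼ im φⱼ` lies in `Σⱼ φⱼ(Hdgᵏ(Hⱼ))`.
Proof: `Σⱼ im φⱼ` is the image of `Φ = Σⱼ φⱼ ∘ prⱼ : ⊕ⱼ Hⱼ → H`, a sub-Hodge structure `S` of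
`H`; `Φ : ⊕ⱼ Hⱼ → S` is a surjective morphism from the polarised structure `⊕ⱼ Hⱼ`, so by
Cor. 2.12 a Hodge class of `S` (= a Hodge class of `H` in `S`) is `Φ(β)` with
`β = (βⱼ) ∈ Hdgᵏ(⊕ⱼ Hⱼ) = Πⱼ Hdgᵏ(Hⱼ)`. [cite: Voisin2025, Cor. 2.12 and proof of Prop. 3.8]
[cite: Jannsen1990MixedMotives, §7, 7.8] [cite: DeligneHodgeII1971, 2.1] -/
theorem mem_iSup_map_hodgeClasses_of_mem_iSup_range {ι : Type w} [Finite ι]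
    {W : ι → Type v} [∀ j, AddCommGroup (W j)] [∀ j, Module ℚ (W j)]
    [∀ j, Module.Finite ℚ (W j)] {H' : ∀ j, HodgeStructure (W j) n}
    (hH' : ∀ j, (H' j).IsPolarizable) {H : HodgeStructure V n} (φ : ∀ j, Hom (H' j) H)
    {k : ℤ} (hk : k + k = n) {v : V} (hv : v ∈ H.hodgeClasses k)
    (hv' : v ∈ ⨆ j, LinearMap.range (φ j).toLinearMap) :
    v ∈ ⨆ j, ((H' j).hodgeClasses k).map (φ j).toLinearMap := by
  classical
  cases nonempty_fintype ι
  obtain ⟨S, hS⟩ := (Hom.piDesc φ).exists_subHodgeStructure_range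
  have hmem : ∀ w, (Hom.piDesc φ).toLinearMap w ∈ S.toSubmodule := fun w ↦ hS ▸ ⟨w, rfl⟩
  set ψ := (Hom.piDesc φ).codRestrict S hmem with hψdef
  have hψ : Function.Surjective ψ.toLinearMap := by
    rintro ⟨u, hu⟩
    have hu' : u ∈ LinearMap.range (Hom.piDesc φ).toLinearMap := hS ▸ hu
    obtain ⟨w, rfl⟩ := hu'
    exact ⟨w, rfl⟩
  have hvS : v ∈ S.toSubmodule := by
    rw [hS, Hom.range_piDesc]
    exact hv'
  have hvH : (⟨v, hvS⟩ : S.toSubmodule) ∈ S.toHodgeStructure.hodgeClasses k :=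
    (S.mem_hodgeClasses_iff k _).2 hv
  obtain ⟨β, hβ, hβv⟩ :=
    ψ.exists_mem_hodgeClasses_eq_of_surjective hψ (IsPolarizable.pi hH') hk hvH
  have hβv' : (Hom.piDesc φ).toLinearMap β = v := congrArg Subtype.val hβv
  rw [mem_hodgeClasses_pi_iff] at hβ
  rw [← hβv', Hom.piDesc_apply]
  exact Submodule.sum_mem _ fun j _ ↦ Submodule.mem_iSup_of_mem j ⟨β j, hβ j, rfl⟩

/-- **Hodge classes lift along a finite family of morphisms of bidegree `(eⱼ, eⱼ)` from polarised
Hodge structures** (the shape of a family of Gysin morphisms `(gⱼ)_* : H^{aⱼ}(Yⱼ) → H^{2q}(X)`,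
`aⱼ + 2eⱼ = 2q`, "morphisms of Hodge structures up to a shift of bidegrees […] called a Tate
twist", p. 23; Cor. 2.12 as used in the proof of Prop. 3.8). Let `H` be a Hodge structure of
weight `n = 2k` on `V`, `Hⱼ` finite-dimensional polarisable Hodge structures of weights `wⱼ` on
`Wⱼ` (`j ∈ ι` finite), `eⱼ ∈ ℤ` with `wⱼ + 2eⱼ = n`, and `φⱼ : Wⱼ → V` linear maps of bidegree
`(eⱼ, eⱼ)`: `(φⱼ)_ℂ (Fᵖ Hⱼ) ⊆ F^{p+eⱼ} H`. Then a Hodge class of `H` lying in `Σⱼ im φⱼ` lies in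
`Σⱼ φⱼ(Hdg^{k−eⱼ}(Hⱼ))`. Proof: `φⱼ` is a morphism `Hⱼ(−eⱼ) → H` from the Tate twist, which
is polarisable (`IsPolarizable.tateTwist`) with `Hdgᵏ(Hⱼ(−eⱼ)) = Hdg^{k−eⱼ}(Hⱼ)`; apply
`mem_iSup_map_hodgeClasses_of_mem_iSup_range`. [cite: Voisin2025, §2.1 (p. 23), Cor. 2.12 and proof of Prop. 3.8]
[cite: VoisinHodgeI2002, §7.3.2] [cite: Jannsen1990MixedMotives, §7, 7.8] -/
theorem mem_iSup_map_hodgeClasses_of_bidegree {ι : Type w} [Finite ι]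
    {W : ι → Type v} [∀ j, AddCommGroup (W j)] [∀ j, Module ℚ (W j)]
    [∀ j, Module.Finite ℚ (W j)] {w : ι → ℤ} {H' : ∀ j, HodgeStructure (W j) (w j)}
    (hH' : ∀ j, (H' j).IsPolarizable) {H : HodgeStructure V n} (e : ι → ℤ)
    (he : ∀ j, w j + 2 * e j = n) (φ : ∀ j, W j →ₗ[ℚ] V)
    (hφ : ∀ j p, ((H' j).F p).map ((φ j).baseChange ℂ) ≤ H.F (p + e j))
    {k : ℤ} (hk : k + k = n) {v : V} (hv : v ∈ H.hodgeClasses k)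
    (hv' : v ∈ ⨆ j, LinearMap.range (φ j)) :
    v ∈ ⨆ j, ((H' j).hodgeClasses (k - e j)).map (φ j) := by
  let T : ∀ j, HodgeStructure (W j) n := fun j ↦
    ((H' j).tateTwist (-e j)).cast (by have := he j; omega)
  let ψ : ∀ j, Hom (T j) H := fun j ↦
    { toLinearMap := φ j
      map_F_le := fun p ↦ by
        have h := hφ j (p + -e j)
        rwa [show p + -e j + e j = p by ring] at h }
  have hT : ∀ j, (T j).IsPolarizable := fun j ↦ ((hH' j).tateTwist _).cast _
  have h := mem_iSup_map_hodgeClasses_of_mem_iSup_range hT ψ hk hv hv'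
  refine SetLike.le_def.1 (iSup_mono fun j ↦ ?_) h
  rintro _ ⟨u, hu, rfl⟩
  refine ⟨u, ?_, rfl⟩
  have hu' : u ∈ (H' j).hodgeClasses (k + -e j) := hu
  rwa [← sub_eq_add_neg] at hu'

/-- **Complexified reading** of `mem_iSup_map_hodgeClasses_of_bidegree` (the abstract form of
`HodgeTheory.Voisin2025_hodgeClass_lift_complexGysin`, whose carriers are complex vector spaces
with a rational structure): with the same data, a Hodge class `v` of `H` whose image `v ⊗ 1`
in `V_ℂ` lies in the sum of the images of the COMPLEXIFIED maps `(φⱼ)_ℂ` has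
`v ⊗ 1 ∈ Σⱼ (φⱼ)_ℂ (span_ℂ {h ⊗ 1 | h ∈ Hdg^{k−eⱼ}(Hⱼ)})` — the passage `ℚ ↝ ℂ` being
`im (φⱼ)_ℂ = (im φⱼ)_ℂ` and `(I ⊗ ℂ) ∩ V = I` (`mem_of_ofRat_mem_baseChange`).
[cite: Voisin2025, Cor. 2.12 and proof of Prop. 3.8] [cite: Jannsen1990MixedMotives, §7, 7.8] -/
theorem ofRat_mem_iSup_map_span_of_bidegree {ι : Type w} [Finite ι]
    {W : ι → Type v} [∀ j, AddCommGroup (W j)] [∀ j, Module ℚ (W j)]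
    [∀ j, Module.Finite ℚ (W j)] {w : ι → ℤ} {H' : ∀ j, HodgeStructure (W j) (w j)}
    (hH' : ∀ j, (H' j).IsPolarizable) {H : HodgeStructure V n} (e : ι → ℤ)
    (he : ∀ j, w j + 2 * e j = n) (φ : ∀ j, W j →ₗ[ℚ] V)
    (hφ : ∀ j p, ((H' j).F p).map ((φ j).baseChange ℂ) ≤ H.F (p + e j))
    {k : ℤ} (hk : k + k = n) {v : V} (hv : v ∈ H.hodgeClasses k)
    (hv' : ofRat v ∈ ⨆ j, LinearMap.range ((φ j).baseChange ℂ)) :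
    ofRat v ∈ ⨆ j, (Submodule.span ℂ
      (ofRat '' ((H' j).hodgeClasses (k - e j) : Set (W j)))).map ((φ j).baseChange ℂ) := by
  have hv'' : v ∈ ⨆ j, LinearMap.range (φ j) := by
    refine mem_of_ofRat_mem_baseChange _ (SetLike.le_def.1 (iSup_le fun j ↦ ?_) hv')
    rw [range_baseChange]
    exact Submodule.baseChange_mono _ (le_iSup (fun j ↦ LinearMap.range (φ j)) j)
  have h := mem_iSup_map_hodgeClasses_of_bidegree hH' e he φ hφ hk hv hv''
  clear hv hv' hv''
  induction h using Submodule.iSup_induction' with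
  | mem j u hu =>
    obtain ⟨u', hu', rfl⟩ := hu
    exact Submodule.mem_iSup_of_mem j
      ⟨ofRat u', Submodule.subset_span ⟨u', hu', rfl⟩, baseChange_ofRat _ _⟩
  | zero =>
    rw [map_zero]
    exact Submodule.zero_mem _
  | add u₁ u₂ _ _ h₁ h₂ =>
    rw [map_add]
    exact Submodule.add_mem _ h₁ h₂

end HodgeStructure

end Literature.AlgebraicGeometry.Motives

end
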